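import Summits.ABC.IUTFork.Conditional.WRowUnconditionalPackages
import Literature.IUT.LogVolume.UnitLogValuationSpectrum
import HarnessLib

/-!
# R-W WINDOW-TABLE «W:HEX-INHABITED-BANDS» — the OUTER log-shell member at LEVEL TWO (no off-cyclotomic side condition on `e` at level one):
# input for the TIE branch of the unconditional triple socket (GAP-LEDGER G-w5d107-g9-1, class `(k, l) = (7, 41)`)

PROOF-ONLY file (D-0012; 0 definitions, 0 `Prop` facts; classical local analysis only) of the abc-iut cell — D-0079 RESCUE sub-cell R-W «WINDOW
Θ-SIDE INEQUALITY», prover seat abc-iut-w5-d107 (gen 9). abc-iut-w4-d094's outer member `WRow.exists_mem_logUnits_rpow_min_le_norm` /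
`WRow.outer_member_min` (`WRowFrey343Packages`, `WRowUnconditionalPackages` §1) — a member of `log_p(𝒪_K^×)` of norm `≥ p^{−min(p^a − a·e, p^b − b·e)/e}`
— needs `e ≠ p^c·(p − 1)` for every `c` (a STRICT turning point of the LEVEL-ONE envelope `min_c (p^c − c·e)`; at a tie the two dominant terms
of `log_p(1 + ϖ)` may cancel, e.g. `log ζ_p = 0` in `ℚ_p(ζ_p)`, `e = p − 1`). This file supplies the LEVEL-TWO twin, whose side condition
`e ≠ 2·p^c·(p − 1)` is disjoint from the level-one ties for odd `p`: the member `log_p(1 + ϖ²)` of norm `‖ϖ‖^{2p^{a₀} − e·a₀}` at the strict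
level-two turning point (abc-iut-c312-3 `LogEnvelope.exists_mem_logUnits_norm_eq_zpow_level`), below BOTH level-two envelope terms
`2·p^a − a·e`, `2·p^b − b·e` (`RamificationCriterion.exponent_min`). USE: at a cyclotomic index `e = p^c·(p − 1)` (the one residual class of the HEX
row: `p = 1231`, `e = 1230`, where `min(2·p^0 − 0, …) = 2` replaces the unavailable `1`) a tie-branch variant of abc-iut-W-row-1's slot socket
`WRow.licence_triple_unconditional_slot` can take `ρout = min(2p^A − A·e, 2p^B − B·e)` with NO `hne`. HONEST SCOPE: classical (Neukirch ANT II (5.5));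
nothing here bears on the printed inequality or on any author; no abc claim. [cite: NeukirchANT1999, Ch. II (5.5)–(5.7)]
-/

noncomputable section

open Set Function Metric

namespace Summit.ABC.IUTFork.Conditional

open Literature.IUT.LogVolume Literature.NumberTheory.GaloisRepresentations.Ultrametric

section Local

variable (p : ℕ) [hp : Fact p.Prime] {K : Type} [NontriviallyNormedField K] [instK : NormedAlgebra ℚ_[p] K]
  [IsUltrametricDist K] [ProperSpace K]

include instK in
/-- **Outer member below two LEVEL-TWO envelope terms**: if `e ≠ 2·p^c·(p−1)` for all `c` (automatic at the level-one ties `e = p^c(p−1)`, `p` odd),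
`log_p(𝒪_K^×)` contains an element of norm `≥ p^{−min(2p^a − a·e, 2p^b − b·e)/e}` — the member `log_p(1 + ϖ²)` of norm `‖ϖ‖^{2p^{a₀} − e·a₀}`
at the strict level-two turning point `a₀` (abc-iut-c312-3 `LogEnvelope.exists_mem_logUnits_norm_eq_zpow_level`), with `2p^{a₀} − e·a₀ ≤ 2p^c − c·e`
for EVERY `c` (`RamificationCriterion.exponent_min`). [cite: NeukirchANT1999, Ch. II (5.5)] -/
theorem WRow.exists_mem_logUnits_rpow_min_le_norm_level_two {e : ℕ} (he : absRamificationIdx p K = e)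
    (hne : ∀ c : ℕ, (e : ℤ) ≠ 2 * (p : ℤ) ^ c * ((p : ℤ) - 1)) (a b : ℕ) :
    ∃ z ∈ logUnits K,
      (p : ℝ) ^ (-(((min (2 * (p : ℤ) ^ a - a * (e : ℤ)) (2 * (p : ℤ) ^ b - b * (e : ℤ)) : ℤ) : ℝ) / (e : ℝ))) ≤ ‖z‖ := by
  subst he
  obtain ⟨ϖ, hϖ⟩ := exists_isUniformizer (F := K)
  obtain ⟨a₀, hlo, hhi⟩ := LogEnvelope.exists_turning_level (p := p) (s := (2 : ℤ)) (by norm_num) (absRamificationIdx p K)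
  have hhi' : (absRamificationIdx p K : ℤ) < 2 * (p : ℤ) ^ a₀ * ((p : ℤ) - 1) := lt_of_le_of_ne hhi (hne a₀)
  have hlo2 : ∀ c < a₀, ((2 : ℕ) : ℤ) * (p : ℤ) ^ c * ((p : ℤ) - 1) < absRamificationIdx p K := by
    intro c hc; exact_mod_cast hlo c hc
  have hhi2 : (absRamificationIdx p K : ℤ) < ((2 : ℕ) : ℤ) * (p : ℤ) ^ a₀ * ((p : ℤ) - 1) := by exact_mod_cast hhi'
  obtain ⟨z, hz, hzn⟩ := LogEnvelope.exists_mem_logUnits_norm_eq_zpow_level p hϖ (a := 2) (by norm_num) hlo2 hhi2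
  refine ⟨z, hz, ?_⟩
  have hP : (2 : ℤ) ≤ (p : ℤ) := by exact_mod_cast hp.out.two_le
  have henv : ∀ c : ℕ, 2 * (p : ℤ) ^ a₀ - (absRamificationIdx p K : ℤ) * (a₀ : ℤ) ≤ 2 * (p : ℤ) ^ c - c * (absRamificationIdx p K : ℤ) := by
    intro c
    have h := RamificationCriterion.exponent_min (S := (2 : ℤ)) (P := (p : ℤ)) (E := (absRamificationIdx p K : ℤ)) (a₀ := a₀)
      (by norm_num) hP hlo hhi c
    linarith
  have hle : 2 * (p : ℤ) ^ a₀ - (absRamificationIdx p K : ℤ) * (a₀ : ℤ) ≤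
      min (2 * (p : ℤ) ^ a - a * (absRamificationIdx p K : ℤ)) (2 * (p : ℤ) ^ b - b * (absRamificationIdx p K : ℤ)) :=
    le_min (henv a) (henv b)
  have hp1 : (1 : ℝ) ≤ (p : ℝ) := by exact_mod_cast hp.out.one_lt.le
  have he0 : (0 : ℝ) < (absRamificationIdx p K : ℝ) := by exact_mod_cast absRamificationIdx_pos p K
  have hle' : (((2 * (p : ℤ) ^ a₀ - (absRamificationIdx p K : ℤ) * (a₀ : ℤ) : ℤ)) : ℝ) ≤
      ((min (2 * (p : ℤ) ^ a - a * (absRamificationIdx p K : ℤ)) (2 * (p : ℤ) ^ b - b * (absRamificationIdx p K : ℤ)) : ℤ) : ℝ) := by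
    exact_mod_cast hle
  have hzn' : ‖z‖ = ‖(ϖ : K)‖ ^ (2 * (p : ℤ) ^ a₀ - (absRamificationIdx p K : ℤ) * (a₀ : ℤ)) := by
    rw [hzn]; push_cast; ring_nf
  rw [hzn', norm_isUniformizer_zpow_eq_rpow p hϖ]
  refine Real.rpow_le_rpow_of_exponent_le hp1 ?_
  rw [neg_le_neg_iff]
  exact div_le_div_of_nonneg_right hle' he0.le

include instK in
/-- **Socket form of the level-two outer member** (binder shape of abc-iut-W-row-1's `WRow.outer_member_min`, the prime read as an integer numeral
`p'`): with `e ≠ 2·p^c·(p−1)` for all `c`, a member of `log_p(𝒪_K^×)` of norm `≥ p^{−ρout/e}`, `ρout = min(2·p'^a − a·e, 2·p'^b − b·e)`.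
[cite: NeukirchANT1999, Ch. II (5.5)] -/
theorem WRow.outer_member_min_level_two {e : ℕ} (hE : absRamificationIdx p K = e)
    (hne : ∀ c : ℕ, (e : ℤ) ≠ 2 * (p : ℤ) ^ c * ((p : ℤ) - 1)) (a b : ℕ) {p' : ℤ} (hp' : (p : ℤ) = p') {ρout : ℤ}
    (hρout : ρout = min (2 * p' ^ a - (a : ℤ) * (e : ℤ)) (2 * p' ^ b - (b : ℤ) * (e : ℤ))) :
    ∃ z ∈ logUnits K, (p : ℝ) ^ (-((ρout : ℝ) / (e : ℝ))) ≤ ‖z‖ := by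
  subst hp'
  rw [hρout]
  exact WRow.exists_mem_logUnits_rpow_min_le_norm_level_two p hE hne a b

end Local

/-- **At a level-one TIE the level-two side condition is automatic** (`p` odd): if `e = p^c·(p−1)` then `e ≠ 2·p^d·(p−1)` for every `d`
(`p^c = 2·p^d` is impossible for odd `p`). Hence the level-two member is available EXACTLY where abc-iut-w4-d094's level-one member is not.
[folklore] -/
theorem WRow.ne_two_mul_pow_mul_sub_one_of_eq (p : ℕ) [hp : Fact p.Prime] {e c : ℕ} (hp2 : p ≠ 2) (he : (e : ℤ) = (p : ℤ) ^ c * ((p : ℤ) - 1)) (d : ℕ) :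
    (e : ℤ) ≠ 2 * (p : ℤ) ^ d * ((p : ℤ) - 1) := by
  rw [he]
  intro h
  have hp1 : (1 : ℤ) < (p : ℤ) := by exact_mod_cast hp.out.one_lt
  have hp0 : (0 : ℤ) < (p : ℤ) - 1 := by linarith
  have h' : (p : ℤ) ^ c = 2 * (p : ℤ) ^ d := by
    have := mul_right_cancel₀ hp0.ne' (by linarith [h] : (p : ℤ) ^ c * ((p : ℤ) - 1) = 2 * (p : ℤ) ^ d * ((p : ℤ) - 1))
    linarith
  have h2 : (2 : ℤ) ∣ (p : ℤ) ^ c := ⟨(p : ℤ) ^ d, by linarith⟩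
  have hodd : Odd (p : ℤ) := by
    have := hp.out.eq_two_or_odd'
    rcases this with h2' | hodd
    · exact absurd h2' hp2
    · exact_mod_cast hodd
  have : ¬ (2 : ℤ) ∣ (p : ℤ) ^ c := by
    rw [Int.two_dvd_ne_zero, Int.odd_iff.mp (hodd.pow)]
  exact this h2


/-! ## Appendix (v2): the outer member at an ARBITRARY level `s ≥ 1` — so that a socket may CHOOSE the level per admissible index -/

section LocalLevel

variable (p : ℕ) [hp : Fact p.Prime] {K : Type} [NontriviallyNormedField K] [instK : NormedAlgebra ℚ_[p] K]
  [IsUltrametricDist K] [ProperSpace K]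

include instK in
/-- **Outer member below two LEVEL-`s` envelope terms** (`s ≥ 1`): if `e ≠ s·p^c·(p−1)` for all `c` (a STRICT turning point of the level-`s`
envelope `min_c (s·p^c − c·e)`), `log_p(𝒪_K^×)` contains an element of norm `≥ p^{−min(s·p^a − a·e, s·p^b − b·e)/e}` — the member `log_p(1 + ϖ^s)`
(abc-iut-c312-3 `LogEnvelope.exists_mem_logUnits_norm_eq_zpow_level`) with `s·p^{a₀} − e·a₀ ≤ s·p^c − c·e` for EVERY `c` (`RamificationCriterion.exponent_min`).
`s = 1` is abc-iut-w4-d094's `WRow.exists_mem_logUnits_rpow_min_le_norm`, `s = 2` the level-two member above; since the ties `e = s·p^c·(p−1)` of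
different levels `s ∈ {1, 2}` never coincide for odd `p`, SOME level `s ≤ 2` is always available. [cite: NeukirchANT1999, Ch. II (5.5)] -/
theorem WRow.exists_mem_logUnits_rpow_min_le_norm_level {e : ℕ} (he : absRamificationIdx p K = e) {s : ℕ} (hs : 1 ≤ s)
    (hne : ∀ c : ℕ, (e : ℤ) ≠ (s : ℤ) * (p : ℤ) ^ c * ((p : ℤ) - 1)) (a b : ℕ) :
    ∃ z ∈ logUnits K,
      (p : ℝ) ^ (-(((min ((s : ℤ) * (p : ℤ) ^ a - a * (e : ℤ)) ((s : ℤ) * (p : ℤ) ^ b - b * (e : ℤ)) : ℤ) : ℝ) / (e : ℝ))) ≤ ‖z‖ := by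
  subst he
  obtain ⟨ϖ, hϖ⟩ := exists_isUniformizer (F := K)
  have hs' : (1 : ℤ) ≤ (s : ℤ) := by exact_mod_cast hs
  obtain ⟨a₀, hlo, hhi⟩ := LogEnvelope.exists_turning_level (p := p) (s := (s : ℤ)) hs' (absRamificationIdx p K)
  have hhi' : (absRamificationIdx p K : ℤ) < (s : ℤ) * (p : ℤ) ^ a₀ * ((p : ℤ) - 1) := lt_of_le_of_ne hhi (hne a₀)
  obtain ⟨z, hz, hzn⟩ := LogEnvelope.exists_mem_logUnits_norm_eq_zpow_level p hϖ (a := s) hs hlo hhi'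
  refine ⟨z, hz, ?_⟩
  have hP : (2 : ℤ) ≤ (p : ℤ) := by exact_mod_cast hp.out.two_le
  have henv : ∀ c : ℕ, (s : ℤ) * (p : ℤ) ^ a₀ - (absRamificationIdx p K : ℤ) * (a₀ : ℤ) ≤ (s : ℤ) * (p : ℤ) ^ c - c * (absRamificationIdx p K : ℤ) := by
    intro c
    have h := RamificationCriterion.exponent_min (S := (s : ℤ)) (P := (p : ℤ)) (E := (absRamificationIdx p K : ℤ)) (a₀ := a₀) hs' hP hlo hhi c
    linarith
  have hle : (s : ℤ) * (p : ℤ) ^ a₀ - (absRamificationIdx p K : ℤ) * (a₀ : ℤ) ≤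
      min ((s : ℤ) * (p : ℤ) ^ a - a * (absRamificationIdx p K : ℤ)) ((s : ℤ) * (p : ℤ) ^ b - b * (absRamificationIdx p K : ℤ)) :=
    le_min (henv a) (henv b)
  have hp1 : (1 : ℝ) ≤ (p : ℝ) := by exact_mod_cast hp.out.one_lt.le
  have he0 : (0 : ℝ) < (absRamificationIdx p K : ℝ) := by exact_mod_cast absRamificationIdx_pos p K
  have hle' : ((((s : ℤ) * (p : ℤ) ^ a₀ - (absRamificationIdx p K : ℤ) * (a₀ : ℤ) : ℤ)) : ℝ) ≤
      ((min ((s : ℤ) * (p : ℤ) ^ a - a * (absRamificationIdx p K : ℤ)) ((s : ℤ) * (p : ℤ) ^ b - b * (absRamificationIdx p K : ℤ)) : ℤ) : ℝ) := by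
    exact_mod_cast hle
  rw [hzn, norm_isUniformizer_zpow_eq_rpow p hϖ]
  refine Real.rpow_le_rpow_of_exponent_le hp1 ?_
  rw [neg_le_neg_iff]
  exact div_le_div_of_nonneg_right hle' he0.le

include instK in
/-- **Socket form of the level-`s` outer member** (binder shape of abc-iut-W-row-1's `WRow.outer_member_min`, the prime read as an integer numeral `p'`):
`s ≥ 1`, `e ≠ s·p^c·(p−1)` for all `c` ⇒ a member of `log_p(𝒪_K^×)` of norm `≥ p^{−ρout/e}`, `ρout = min(s·p'^a − a·e, s·p'^b − b·e)`.
[cite: NeukirchANT1999, Ch. II (5.5)] -/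
theorem WRow.outer_member_min_level {e : ℕ} (hE : absRamificationIdx p K = e) {s : ℕ} (hs : 1 ≤ s)
    (hne : ∀ c : ℕ, (e : ℤ) ≠ (s : ℤ) * (p : ℤ) ^ c * ((p : ℤ) - 1)) (a b : ℕ) {p' : ℤ} (hp' : (p : ℤ) = p') {ρout : ℤ}
    (hρout : ρout = min ((s : ℤ) * p' ^ a - (a : ℤ) * (e : ℤ)) ((s : ℤ) * p' ^ b - (b : ℤ) * (e : ℤ))) :
    ∃ z ∈ logUnits K, (p : ℝ) ^ (-((ρout : ℝ) / (e : ℝ))) ≤ ‖z‖ := by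
  subst hp'
  rw [hρout]
  exact WRow.exists_mem_logUnits_rpow_min_le_norm_level p hE hs hne a b

end LocalLevel

/-- **Some level `s ∈ {1, 2}` is off its ties** (`p` odd): for every `e`, either `e ≠ p^c·(p−1)` for all `c`, or `e ≠ 2·p^c·(p−1)` for all `c`
(`p^c = 2·p^d` is impossible). [folklore] -/
theorem WRow.exists_level_le_two_forall_ne (p : ℕ) [hp : Fact p.Prime] (hp2 : p ≠ 2) (e : ℕ) :
    ∃ s : ℕ, 1 ≤ s ∧ s ≤ 2 ∧ ∀ c : ℕ, (e : ℤ) ≠ (s : ℤ) * (p : ℤ) ^ c * ((p : ℤ) - 1) := by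
  by_cases h : ∀ c : ℕ, (e : ℤ) ≠ (p : ℤ) ^ c * ((p : ℤ) - 1)
  · exact ⟨1, le_rfl, by norm_num, fun c => by rw [Nat.cast_one, one_mul]; exact h c⟩
  · push Not at h
    obtain ⟨c, hc⟩ := h
    refine ⟨2, by norm_num, le_rfl, fun d => ?_⟩
    have := WRow.ne_two_mul_pow_mul_sub_one_of_eq p hp2 hc d
    push_cast
    exact this

end Summit.ABC.IUTFork.Conditional

end
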